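/-
Copyright: the b2b-balaban cell (near-miss cell 7), T⁴-continuum fan-out, lineage t4-ne7b-p1 (node U5c COUNT member).
Released under the licence of the surrounding project.
-/
import Summits.QuantumFields.BalabanUV.T4Continuum.Support.ZoneTorus
import Summits.QuantumFields.BalabanUV.T4Continuum.Support.ZoneCrowd
import Summits.QuantumFields.BalabanUV.T4Continuum.Support.ZoneTransport

/-!
# Zone torus × crowding: the `hlabZ` multiplicity factor ON THE TORUS, from the dictionary side

Summits-side support leaf of the T⁴-continuum cell (rung (B)+1 on a FINITE torus only; NOT infinite volume, NOT the
mass gap, NOT the Clay statement; NOT a proof of the spine estimate NE7b).  Lineage `t4-ne7b-p1` (generation 20),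
node U5c, wall (GM), located item G-ne7bp1g18-2.  [folklore] bookkeeping; nothing is quoted from print and nothing
printed is asserted; no `[cite:]` tag.

WHAT.  The JOINT of the three zone leaves on the dictionary's alphabet `PEv`:
`Support/ZoneTorus.lean` (root-position binders discharged on the torus `TCell d (n·L^K)`), `Support/ZoneCrowd.lean`
(`zoneFactor_le_prod_Q`: drivers against the weighted crowding under chronology) and `Support/ZoneTransport.lean`
(finite alphabet `↥E` ↔ `Gen PEv`).  §1 adds the two PULL-BACKS the joint needs and the tree lacked: well-formedness
and chronology of `gmap f G` descend to `G` (`wf_of_gmap`, `chrono_of_gmap`; no injectivity needed), whence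
`wf_grestrict`, `chrono_grestrict`.  §2 THE JOINT **`card_admZSet_grestrict_le`**: for a genealogy `G : Gen PEv` that is
well-formed, CHRONOLOGICAL, with kind-`0` births and non-kind-`0` mergers, events inside a finset `E`, and extents
`extP : ℕ → Gen PEv → ℝ`, nonnegative, obeying the AFFINE CONTRACTION LAW `extP t X ≤ C₀·qZ wtPEv σ step X t + c₀`
(`σ ≥ 0`), the zone-admissible torus placements `↥E → TCell d (n·L^K)` of its finite-alphabet restriction with the
root piece at `c` number at most

  `Kz ^ #merges G · (∏_{e ∈ merges G} Q(wcnt G, σ, step e)^p) · Λ′ ^ partnerAges step G`,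
  `Kz = 2^d·(C₀ + 2c₀ + 1)^d`, `p = d`, `Λ′ = L^d`

— LITERALLY the multiplicity factor of the chain binder `hlabZ` of
`Support/PartnerMultiplicityZ.exists_irThreshold_relWeightBoundZ` (and of `…Floor.exists_irThreshold_relWeightBoundZ_floor`)
at these constants; `one_le_Kz` records the chain's side condition `1 ≤ Kz`.  The chain's other side conditions at
these constants read `0 ≤ p` (trivial) and the placement rate `L^d·e^{ε}·e^{−κ₁} ≤ 1`, i.e. `κ₁ ≥ d·log L + ε` — the
row's survival condition «p₀(g)∕N > 4 log L·(1+o(1))» at `d = 4` (displayed there, not here).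

WHAT REMAINS DISPLAYED on the (GM) side after this leaf (inputs of `card_admZSet_grestrict_le`): the extents `extP` with
the affine contraction law, the chronology `Chrono PEv.step G`, the kinds (both supplied by the dictionary's
`Consistent` for births∕mergers — `PartnerMultiplicityG.kind_eq_zero_of_mem_births` — except `Chrono`), and the reading
(ID) itself (G-ne7bp1g9-1): that Bałaban's merger partners ARE `nearT` within `extP X + extP Y`, and the summation of
the raw price over positioned histories that turns this COUNT into the bound on `y K j z b Q`.  The per-record price
(E2)∕(R1) (G-ne7bp1-1) is untouched.

HONEST DEPENDENCY (cell): continuum YM on T⁴ ⇐ BetaPertH ∧ nine spine estimates (0/9 proved); BetaPertH ⇐ (D1) ∧ (D4)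
∧ CAP+tail.  This file changes none of it.
-/

open Finset
open Literature.MathematicalPhysics.QuantumFieldTheory.Balaban1983to89
open T4PersistenceDictionary T4PartnerMultiplicity
open Summit.QuantumFields.BalabanUV.T4Continuum.PlacementSkeleton
open Summit.QuantumFields.BalabanUV.T4Continuum.Crowding
open Summit.QuantumFields.BalabanUV.T4Continuum.ZoneSkeleton
open Summit.QuantumFields.BalabanUV.T4Continuum.ZoneCrowd

namespace Summit.QuantumFields.BalabanUV.T4Continuum.ZoneTorus

noncomputable section

/-! ## §1 Pull-backs along `gmap`: well-formedness and chronology descend -/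

section Pullback

variable {ε ε' : Type*} [DecidableEq ε] [DecidableEq ε']

/-- **WELL-FORMEDNESS DESCENDS**: if `gmap f G` is well-formed for the window table `W'`, then `G` is well-formed for
`W' ∘ f` (any `f`; the converse `wf_gmap` needs `f` injective). [folklore] -/
theorem wf_of_gmap (f : ε → ε') (W' : ε' → ℕ) : ∀ {G : Gen ε}, (gmap f G).WF W' → G.WF (W' ∘ f)
  | Gen.born _ _, _ => trivial
  | Gen.renew G e h, hW => by
      obtain ⟨hG, he, h1, h2⟩ := hW
      refine ⟨wf_of_gmap f W' hG, fun he' => he ?_, ?_, ?_⟩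
      · rw [events_gmap]; exact mem_image_of_mem f he'
      · simpa [gmap] using h1
      · simpa [gmap] using h2
  | Gen.merge X Y e, hW => by
      obtain ⟨hX, hY, heX, heY, hd, h1, h2⟩ := hW
      refine ⟨wf_of_gmap f W' hX, wf_of_gmap f W' hY, fun he' => heX ?_, fun he' => heY ?_, ?_, ?_, ?_⟩
      · rw [events_gmap]; exact mem_image_of_mem f he'
      · rw [events_gmap]; exact mem_image_of_mem f he'
      · rw [events_gmap, events_gmap] at hd
        exact disjoint_left.2 fun x hxX hxY =>
          disjoint_left.1 hd (mem_image_of_mem f hxX) (mem_image_of_mem f hxY)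
      · simpa [gmap] using h1
      · simpa [gmap] using h2

/-- **CHRONOLOGY DESCENDS**: `Chrono st' (gmap f G) → Chrono (st' ∘ f) G`. [folklore] -/
theorem chrono_of_gmap (f : ε → ε') (st' : ε' → ℕ) : ∀ {G : Gen ε}, Chrono st' (gmap f G) → Chrono (st' ∘ f) G
  | Gen.born _ _, _ => trivial
  | Gen.renew G _ _, h => chrono_of_gmap f st' (G := G) h
  | Gen.merge X Y e, h => by
      refine ⟨chrono_of_gmap f st' h.1, chrono_of_gmap f st' h.2.1, fun w hw => ?_⟩
      have hw' : f w ∈ form (gmap f X) ∪ form (gmap f Y) := by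
        rw [form_gmap, form_gmap, ← image_union]; exact mem_image_of_mem f hw
      exact h.2.2 (f w) hw'

/-- the finite-alphabet restriction of a well-formed genealogy is well-formed [folklore] -/
theorem wf_grestrict (W' : ε' → ℕ) (E : Finset ε') (G : Gen ε') (h : G.events ⊆ E) (hW : G.WF W') :
    (grestrict E G h).WF (W' ∘ Subtype.val) :=
  wf_of_gmap Subtype.val W' (by rw [gmap_grestrict]; exact hW)

/-- the finite-alphabet restriction of a chronological genealogy is chronological [folklore] -/
theorem chrono_grestrict (st' : ε' → ℕ) (E : Finset ε') (G : Gen ε') (h : G.events ⊆ E) (hc : Chrono st' G) :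
    Chrono (st' ∘ Subtype.val) (grestrict E G h) :=
  chrono_of_gmap Subtype.val st' (by rw [gmap_grestrict]; exact hc)

end Pullback

/-! ## §2 The joint: the `hlabZ` multiplicity factor on the torus -/

/-- the chain's side condition `1 ≤ Kz` at `Kz = 2^d·(C₀ + 2c₀ + 1)^d` [folklore] -/
theorem one_le_Kz {C₀ c₀ : ℝ} (hC : 0 ≤ C₀) (hc : 0 ≤ c₀) (d : ℕ) :
    (1 : ℝ) ≤ (2 : ℝ) ^ d * (C₀ + 2 * c₀ + 1) ^ d :=
  one_le_mul_of_one_le_of_one_le (one_le_pow₀ (by norm_num)) (one_le_pow₀ (by linarith))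

section Joint

variable {d : ℕ}

open scoped Classical

/-- **THE `hlabZ` MULTIPLICITY FACTOR ON THE TORUS.**  For `G : Gen PEv` well-formed (`W`), chronological, with
kind-`0` births and non-kind-`0` mergers, events inside `E`, and nonnegative extents under the affine contraction
law `extP t X ≤ C₀·qZ wtPEv σ step X t + c₀` (`C₀, c₀, σ ≥ 0`): the zone-admissible torus placements of the
restriction `grestrict E G hE` with the root piece at `c` number at most
`Kz ^ #merges G · (∏_{e ∈ merges G} Q(wcnt G, σ, step e)^(d:ℝ)) · (L^d) ^ partnerAges step G`,
`Kz = 2^d·(C₀+2c₀+1)^d` — the multiplicity factor of `PartnerMultiplicityZ`'s binder `hlabZ` at `p = d`, `Λ′ = L^d`.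
[folklore] -/
theorem card_admZSet_grestrict_le (W : PEv → ℕ) (n : ℕ) {L : ℕ} (hL : 1 ≤ L) (K : ℕ)
    (extP : ℕ → Gen PEv → ℝ) (hext0 : ∀ t X, 0 ≤ extP t X) {C₀ c₀ σ : ℝ} (hC : 0 ≤ C₀) (hc : 0 ≤ c₀)
    (hσ : 0 ≤ σ) (hext : ∀ t X, extP t X ≤ C₀ * qZ wtPEv σ PEv.step X t + c₀)
    {G : Gen PEv} (hW : G.WF W) (hchr : Chrono PEv.step G)
    (hk0 : ∀ b ∈ births G, b.kind = 0) (hk2 : ∀ m ∈ merges G, m.kind ≠ 0)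
    (E : Finset PEv) (hE : G.events ⊆ E) (c c₀' : TCell d (n * L ^ K)) :
    ((admZSet (nearT n L K) (fun t Z => extP t (gmap Subtype.val Z)) (PEv.step ∘ Subtype.val)
        (grestrict E G hE) (grestrict E G hE).root c c₀').card : ℝ) ≤
      ((2 : ℝ) ^ d * (C₀ + 2 * c₀ + 1) ^ d) ^ (merges G).card *
        (∏ e ∈ merges G, Q (wcnt G) σ e.step ^ (d : ℝ)) * ((L : ℝ) ^ d) ^ partnerAges PEv.step G := by
  set G' := grestrict E G hE with hG'
  have hGG : gmap Subtype.val G' = G := gmap_grestrict E G hE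
  have hinj : Function.Injective (Subtype.val : ↥E → PEv) := Subtype.val_injective
  -- the extents and the law, read on the finite alphabet
  have hq : ∀ (Z : Gen ↥E) (t : ℕ), qZ wtPEv σ PEv.step (gmap Subtype.val Z) t =
      qZ (wtPEv ∘ Subtype.val) σ (PEv.step ∘ Subtype.val) Z t := fun Z t => qZ_gmap hinj wtPEv σ PEv.step Z t
  have hext' : ∀ (t : ℕ) (Z : Gen ↥E), extP t (gmap Subtype.val Z) ≤
      C₀ * qZ (wtPEv ∘ Subtype.val) σ (PEv.step ∘ Subtype.val) Z t + c₀ := fun t Z => by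
    rw [← hq]; exact hext t _
  -- (1) the torus count on the finite alphabet
  have h1 := card_admZSet_root_le_torus (W ∘ Subtype.val) n hL K (fun t Z => extP t (gmap Subtype.val Z))
    (fun t Z => hext0 t _) (PEv.step ∘ Subtype.val) hC hc hσ (wtPEv ∘ Subtype.val)
    (fun w => one_le_wtPEv w.1) hext' (wf_grestrict W E G hE hW) c c₀'
  -- (2) transport of the three structural quantities to `G = gmap val G'`
  have hpa : partnerAges (PEv.step ∘ Subtype.val) G' = partnerAges PEv.step G := by
    rw [← hGG, partnerAges_gmap]
  have hmc : mergeCount G' = mergeCount G := by rw [← hGG, mergeCount_gmap]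
  have hmp : mergeProd (fun Z e => qZ (wtPEv ∘ Subtype.val) σ (PEv.step ∘ Subtype.val) Z
        ((PEv.step ∘ Subtype.val) e) ^ d) G' =
      mergeProd (fun Z e => qZ wtPEv σ PEv.step Z e.step ^ d) G := by
    rw [← hGG, mergeProd_gmap]
    congr 1
    funext Z e
    rw [hq]
    rfl
  rw [hpa, hmc, hmp] at h1
  -- (3) the crowding joint on the `PEv` side
  have h2 := zoneFactor_le_prod_Q W hW hk0 hk2 hchr hσ (M₀ := (2 : ℝ) ^ d) (C₀ := C₀ + 2 * c₀)
    (by positivity) (by positivity) d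
  calc ((admZSet (nearT n L K) (fun t Z => extP t (gmap Subtype.val Z)) (PEv.step ∘ Subtype.val)
          G' G'.root c c₀').card : ℝ)
      ≤ ((L : ℝ) ^ d) ^ partnerAges PEv.step G * (((2 : ℝ) ^ d * (C₀ + 2 * c₀ + 1) ^ d) ^ mergeCount G *
          mergeProd (fun Z e => qZ wtPEv σ PEv.step Z e.step ^ d) G) := h1
    _ ≤ ((L : ℝ) ^ d) ^ partnerAges PEv.step G * (((2 : ℝ) ^ d * (C₀ + 2 * c₀ + 1) ^ d) ^ (merges G).card *
          ∏ e ∈ merges G, Q (wcnt G) σ e.step ^ (d : ℝ)) :=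
        mul_le_mul_of_nonneg_left h2 (by positivity)
    _ = _ := by ring

end Joint

/-! ## §3 Sanity -/

namespace Sanity

/-- the chain's side condition at `d = 4`, `C₀ = 3`, `c₀ = 1∕2`: `1 ≤ 2^4 · 5^4` -/
theorem Kz_example : (1 : ℝ) ≤ (2 : ℝ) ^ 4 * ((3 : ℝ) + 2 * (1 / 2) + 1) ^ 4 :=
  one_le_Kz (by norm_num) (by norm_num) 4

/-- pull-back of well-formedness on the two-leaf merger mapped from `Fin 3` into `ℕ` (windows `W' ≡ 2`) -/
theorem wf_pullback_example :
    (Gen.merge (Gen.born (0 : Fin 3) 0) (Gen.born 1 1) 2).WF ((fun _ : ℕ => 2) ∘ (fun i : Fin 3 => (i : ℕ))) :=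
  wf_of_gmap (fun i : Fin 3 => (i : ℕ)) (fun _ => 2)
    (by rw [show gmap (fun i : Fin 3 => (i : ℕ)) (Gen.merge (Gen.born 0 0) (Gen.born 1 1) 2) =
        Gen.merge (Gen.born 0 0) (Gen.born 1 1) 2 from rfl]; simp [Gen.WF])

/-- the scale-`1` cells of the `d = 1` torus with `n = 1`, `L = 2`, `K = 2` (`ℤ∕4`): exactly `2` (`{0, 2}`) -/
theorem cells_example : (cellsAt (d := 1) 1 2 2 1).card = 2 := by
  rw [card_cellsAt 1 (by norm_num) (by norm_num)]; norm_num

end Sanity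

end

end Summit.QuantumFields.BalabanUV.T4Continuum.ZoneTorus
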